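import Summits.KontsevichZagierPeriods.Zeta5Search.WedgeDictionaryRankTwo
import HarnessLib

/-!
# The wedge dictionary on the fan `b = (n; 2, 0⁶)` by rank two (cell `pub-zeta5`, P1)

HONEST FRAMING: systematic search; no irrationality claim unless certified.

OUR work (Summit side), P1 seat generation 3: the first NEW member of the fan `(n;k,0⁶)` obtained WITHOUT a creative-telescoping
certificate, by gen-1 g4's rank-two reduction (`WedgeDictionaryRankTwo`): with `Π_{(n;2,0⁶)} = y(y+(n−1))`,
`Π_{(n;3,0⁶)} = y(y+(n−1))(y+2(n−2))` and the summable `Φ₀ = −n(3y²+4n²y+n⁴)` (`g₀ = 1`), `Φ₁ = (1−3n)y³ + (3n²−4n³)y² + (n⁴−n⁵)y`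
(`g₁ = x(x+n−1)`), the decomposition certificates are
`Π₂ = −n⁴/3 + (n − 1 − 4n²/3)·y − Φ₀/(3n)` and
`Π₃ = n⁴(4n³−12n²+18n−5)/(3(3n−1)) + (13n⁵−45n⁴+90n³−80n²+54n−12)/(3(3n−1))·y + (4n³−12n²+18n−5)/(3n(3n−1))·Φ₀ − Φ₁/(3n−1)`,
whence (`quadM3_fan_two`) `M₃(n;2,0⁶) = n⁴(n−1)⁵/(3(3n−1))·M₃(n;0⁷) = (−1)ⁿ·4·(3n−2)!·(n(n−1))⁵/n!¹⁵` for `n ≥ 2` — gen-1 g4's fan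
formula `M₃(n;k,0⁶) = (−1)ⁿ4(3n−k)!(n!/(n−k)!)⁵/n!¹⁵` at `k = 2` (previously exact-checked only; `k = 0, 1` are `quadM3_bCorner`,
`quadM3_bCorner'`).
-/

noncomputable section

open Finset Polynomial

namespace Summit.KontsevichZagierPeriods.Zeta5Search.WedgeDictionary

open Summit.KontsevichZagierPeriods.Zeta5Search.DualSeries

/-- The fan point `b = (n; 2, 0⁶)`. -/
def bFan2 (n : ℕ) : ℕ → ℤ := Function.update (bCorner n) 1 2

/-- Values of `bFan2`. -/
theorem bFan2_apply (n j : ℕ) : bFan2 n j = if j = 0 then (n : ℤ) else if j = 1 then 2 else 0 := by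
  by_cases h1 : j = 1
  · subst h1; simp [bFan2]
  · rw [bFan2, Function.update_of_ne h1]; simp [bCorner, h1]

/-- `bFan2 n 0 = n`. -/
theorem bFan2_zero (n : ℕ) : bFan2 n 0 = n := by rw [bFan2_apply]; simp

/-- The fan point is in the box for `n ≥ 1`, with `d = 3n − 2`. -/
theorem inBox_bFan2 (n : ℕ) (hn : 1 ≤ n) : InBox (bFan2 n) ∧ dOf (bFan2 n) = 3 * (n : ℤ) - 2 := by
  refine ⟨⟨by rw [bFan2_zero]; positivity, fun j hj => ?_⟩, ?_⟩
  · rw [bFan2_apply, bFan2_zero]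
    have := mem_range.1 hj
    split_ifs <;> omega
  · unfold dOf
    rw [bFan2_zero, show ∑ j ∈ range 7, bFan2 n (j + 1) = 2 by simp [bFan2_apply]]

/-- The second summable polynomial `Φ₁ = (1−3N)Y³ + (3N²−4N³)Y² + (N⁴−N⁵)Y` (`g₁ = X(X+N−1)`). -/
def PhiOne (N : ℕ) : ℚ[X] :=
  C (1 - 3 * (N : ℚ)) * X ^ 3 + C (3 * (N : ℚ) ^ 2 - 4 * (N : ℚ) ^ 3) * X ^ 2 + C ((N : ℚ) ^ 4 - (N : ℚ) ^ 5) * X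

/-- `Φ₁` is summable: `(2X+N)Φ₁(X(X+N)) = g₁(X+1)X⁶ − g₁(X+N)⁶`, `g₁ = X(X+N−1)`. -/
theorem polyNum_PhiOne (N : ℕ) : polyNum N (PhiOne N) =
    (X * (X + C ((N : ℚ) - 1))).comp (X + C 1) * X ^ 6 - (X * (X + C ((N : ℚ) - 1))) * (X + C (N : ℚ)) ^ 6 := by
  apply Polynomial.funext; intro x
  simp only [polyNum, PhiOne, eval_mul, eval_add, eval_sub, eval_comp, eval_pow, eval_C, eval_X]
  ring

/-- `Π_{(n;2,0⁶)} = X(X + (n−1))`. -/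
theorem PiPoly_bFan2 (n : ℕ) : PiPoly (bFan2 n) = X * (X + C ((n : ℚ) - 1)) := by
  unfold PiPoly
  rw [prod_eq_single_of_mem 0 (by simp)]
  · rw [show (bFan2 n (0 + 1)).toNat = 2 by rw [bFan2_apply]; simp, bFan2_zero]
    simp [prod_range_succ]
  · intro j _ hj0
    rw [show (bFan2 n (j + 1)).toNat = 0 by rw [bFan2_apply]; simp [hj0]]
    simp

/-- `Π_{(n;3,0⁶)} = X(X + (n−1))(X + 2(n−2))`. -/
theorem PiPoly_bFan3 (n : ℕ) :
    PiPoly (Function.update (bFan2 n) (0 + 1) (bFan2 n (0 + 1) + 1)) = X * (X + C ((n : ℚ) - 1)) * (X + C (2 * ((n : ℚ) - 2))) := by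
  unfold PiPoly
  rw [Function.update_of_ne (show (0 : ℕ) ≠ 0 + 1 by norm_num), prod_eq_single_of_mem 0 (by simp)]
  · rw [show (Function.update (bFan2 n) (0 + 1) (bFan2 n (0 + 1) + 1) (0 + 1)).toNat = 3 by
      rw [Function.update_self, bFan2_apply]; simp, bFan2_zero]
    apply Polynomial.funext; intro x
    simp only [prod_range_succ, prod_range_zero, one_mul, eval_mul, eval_add, eval_X, eval_C]
    push_cast
    ring
  · intro j _ hj0
    rw [Function.update_of_ne (by omega), show (bFan2 n (j + 1)).toNat = 0 by rw [bFan2_apply]; simp [hj0]]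
    simp

/-- **The fan at `k = 2` by rank two**: `M₃(n;2,0⁶) = n⁴(n−1)⁵/(3(3n−1))·M₃(n;0⁷)` for `n ≥ 2`. -/
theorem quadM3_fan_two (n : ℕ) (hn : 2 ≤ n) :
    quadM3 (bFan2 n) = (n : ℚ) ^ 4 * ((n : ℚ) - 1) ^ 5 / (3 * (3 * (n : ℚ) - 1)) * quadM3 (bCorner n) := by
  obtain ⟨hb, hd⟩ := inBox_bFan2 n (by omega)
  have hN0 : (bFan2 n 0).toNat = n := by rw [bFan2_zero]; simp
  have hNq : (n : ℚ) ≠ 0 := by exact_mod_cast (show n ≠ 0 by omega)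
  have h3 : (3 * (n : ℚ) - 1) ≠ 0 := by
    have : (2 : ℚ) ≤ n := by exact_mod_cast hn
    intro h; linarith
  have key := quadM3_eq_of_rank_two (bFan2 n) hb (by rw [hd]; omega) (by rw [hN0]; omega) (i := 0) (by simp)
    (by rw [bFan2_zero, bFan2_apply]; simp; omega)
    {0, 1} (fun k => if k = 0 then PhiZero n else PhiOne n) (fun k => if k = 0 then 1 else X * (X + C ((n : ℚ) - 1)))
    (fun k => if k = 0 then -1 / (3 * (n : ℚ)) else 0)
    (fun k => if k = 0 then (4 * (n : ℚ) ^ 3 - 12 * (n : ℚ) ^ 2 + 18 * n - 5) / (3 * n * (3 * (n : ℚ) - 1))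
      else -1 / (3 * (n : ℚ) - 1))
    (-(n : ℚ) ^ 4 / 3) (-(4 * (n : ℚ) ^ 2) / 3 + n - 1)
    ((n : ℚ) ^ 4 * (4 * (n : ℚ) ^ 3 - 12 * (n : ℚ) ^ 2 + 18 * n - 5) / (3 * (3 * (n : ℚ) - 1)))
    ((13 * (n : ℚ) ^ 5 - 45 * (n : ℚ) ^ 4 + 90 * (n : ℚ) ^ 3 - 80 * (n : ℚ) ^ 2 + 54 * n - 12) / (3 * (3 * (n : ℚ) - 1)))
    (fun k hk => by
      rw [hN0]
      simp only [mem_insert, mem_singleton] at hk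
      rcases hk with rfl | rfl
      · simp only [if_true]; exact polyNum_PhiZero n
      · simp only [one_ne_zero, if_false]; exact polyNum_PhiOne n)
    (fun k hk => by
      rw [hN0]
      simp only [mem_insert, mem_singleton] at hk
      rcases hk with rfl | rfl
      · simp; omega
      · simp only [one_ne_zero, if_false]
        have : (X * (X + C ((n : ℚ) - 1))).natDegree ≤ 2 := by compute_degree!
        omega)
    (by
      rw [PiPoly_bFan2, sum_pair (by norm_num)]
      simp only [if_true, one_ne_zero, if_false, PhiZero]
      apply Polynomial.funext; intro x
      simp only [eval_add, eval_mul, eval_C, eval_X, eval_pow, eval_neg, neg_mul]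
      field_simp
      ring)
    (by
      rw [PiPoly_bFan3, sum_pair (by norm_num)]
      simp only [if_true, one_ne_zero, if_false, PhiZero, PhiOne]
      apply Polynomial.funext; intro x
      simp only [eval_add, eval_mul, eval_C, eval_X, eval_pow, eval_neg, neg_mul]
      set k := 3 * (n : ℚ) - 1 with hk
      rw [show (1 - 3 * (n : ℚ)) = -k by rw [hk]; ring]
      field_simp
      rw [hk]
      ring)
  rw [key, hN0]
  congr 1
  field_simp
  ring

/-- **gen-1 g4's fan formula at `k = 2`**: `M₃(n;2,0⁶) = (−1)ⁿ·4·(3n−2)!·(n(n−1))⁵/n!¹⁵` for `n ≥ 2`. -/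
theorem quadM3_fan_two_closed (n : ℕ) (hn : 2 ≤ n) :
    quadM3 (bFan2 n) = (-1) ^ n * 4 * ((3 * n - 2).factorial : ℚ) * ((n : ℚ) * ((n : ℚ) - 1)) ^ 5 / (n.factorial : ℚ) ^ 15 := by
  rw [quadM3_fan_two n hn, quadM3_bCorner]
  obtain ⟨m, rfl⟩ : ∃ m, n = m + 2 := ⟨n - 2, by omega⟩
  rw [show 3 * (m + 2) - 2 = 3 * m + 4 by omega]
  have hf : ((3 * (m + 2)).factorial : ℚ) = (3 * m + 6) * (3 * m + 5) * ((3 * m + 4).factorial : ℚ) := by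
    rw [show 3 * (m + 2) = (3 * m + 4) + 1 + 1 by omega, Nat.factorial_succ, Nat.factorial_succ]
    push_cast
    ring
  rw [hf]
  push_cast
  rw [show (3 * ((m : ℚ) + 2) - 1) = 3 * m + 5 by ring]
  have h5 : (3 * (m : ℚ) + 5) ≠ 0 := by positivity
  have hF : (((m + 2).factorial : ℕ) : ℚ) ≠ 0 := by positivity
  field_simp
  ring

/-! ### The fan at `k = 3` (appended): `M₃(n;3,0⁶) = (−1)ⁿ·4·(3n−3)!·(n(n−1)(n−2))⁵/n!¹⁵`, `n ≥ 3` -/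

/-- The fan point `b = (n; 3, 0⁶)` as the partner of `(n; 2, 0⁶)`. -/
def bFan3 (n : ℕ) : ℕ → ℤ := Function.update (bFan2 n) (0 + 1) (bFan2 n (0 + 1) + 1)

/-- Values of `bFan3`. -/
theorem bFan3_apply (n j : ℕ) : bFan3 n j = if j = 0 then (n : ℤ) else if j = 1 then 3 else 0 := by
  by_cases h1 : j = 1
  · subst h1; simp [bFan3, bFan2_apply]
  · rw [bFan3, Function.update_of_ne h1, bFan2_apply]; simp [h1]

/-- `bFan3 n 0 = n`. -/
theorem bFan3_zero (n : ℕ) : bFan3 n 0 = n := by rw [bFan3_apply]; simp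

/-- The fan point `k = 3` is in the box for `n ≥ 2`, with `d = 3n − 3`. -/
theorem inBox_bFan3 (n : ℕ) (hn : 2 ≤ n) : InBox (bFan3 n) ∧ dOf (bFan3 n) = 3 * (n : ℤ) - 3 := by
  refine ⟨⟨by rw [bFan3_zero]; positivity, fun j hj => ?_⟩, ?_⟩
  · rw [bFan3_apply, bFan3_zero]
    have := mem_range.1 hj
    split_ifs <;> omega
  · unfold dOf
    rw [bFan3_zero, show ∑ j ∈ range 7, bFan3 n (j + 1) = 3 by simp [bFan3_apply]]

/-- The third summable polynomial `Φ₂ = (2−3N)Y⁴ + (6N²−4N³−2N)Y³ + (2N⁴−N⁵−N³)Y²` (`g₂ = (X(X+N−1))²`). -/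
def PhiTwo (N : ℕ) : ℚ[X] :=
  C (2 - 3 * (N : ℚ)) * X ^ 4 + C (6 * (N : ℚ) ^ 2 - 4 * (N : ℚ) ^ 3 - 2 * (N : ℚ)) * X ^ 3 +
    C (2 * (N : ℚ) ^ 4 - (N : ℚ) ^ 5 - (N : ℚ) ^ 3) * X ^ 2

/-- `Φ₂` is summable: `(2X+N)Φ₂(X(X+N)) = g₂(X+1)X⁶ − g₂(X+N)⁶`, `g₂ = (X(X+N−1))²`. -/
theorem polyNum_PhiTwo (N : ℕ) : polyNum N (PhiTwo N) =
    ((X * (X + C ((N : ℚ) - 1))) ^ 2).comp (X + C 1) * X ^ 6 - (X * (X + C ((N : ℚ) - 1))) ^ 2 * (X + C (N : ℚ)) ^ 6 := by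
  apply Polynomial.funext; intro x
  simp only [polyNum, PhiTwo, eval_mul, eval_add, eval_sub, eval_comp, eval_pow, eval_C, eval_X]
  ring

/-- `Π_{(n;4,0⁶)} = X(X + (n−1))(X + 2(n−2))(X + 3(n−3))`. -/
theorem PiPoly_bFan4 (n : ℕ) : PiPoly (Function.update (bFan3 n) (0 + 1) (bFan3 n (0 + 1) + 1)) =
    X * (X + C ((n : ℚ) - 1)) * (X + C (2 * ((n : ℚ) - 2))) * (X + C (3 * ((n : ℚ) - 3))) := by
  unfold PiPoly
  rw [Function.update_of_ne (show (0 : ℕ) ≠ 0 + 1 by norm_num), prod_eq_single_of_mem 0 (by simp)]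
  · rw [show (Function.update (bFan3 n) (0 + 1) (bFan3 n (0 + 1) + 1) (0 + 1)).toNat = 4 by
      rw [Function.update_self, bFan3_apply]; simp, bFan3_zero]
    apply Polynomial.funext; intro x
    simp only [prod_range_succ, prod_range_zero, one_mul, eval_mul, eval_add, eval_X, eval_C]
    push_cast
    ring
  · intro j _ hj0
    rw [Function.update_of_ne (by omega), show (bFan3 n (j + 1)).toNat = 0 by rw [bFan3_apply]; simp [hj0]]
    simp

/-- **The fan at `k = 3` by rank two**: `M₃(n;3,0⁶) = n⁴(n−1)⁵(n−2)⁵/(3(3n−1)(3n−2))·M₃(n;0⁷)` for `n ≥ 3`. -/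
theorem quadM3_fan_three (n : ℕ) (hn : 3 ≤ n) :
    quadM3 (bFan3 n) = (n : ℚ) ^ 4 * ((n : ℚ) - 1) ^ 5 * ((n : ℚ) - 2) ^ 5 / (3 * (3 * (n : ℚ) - 1) * (3 * (n : ℚ) - 2)) *
      quadM3 (bCorner n) := by
  obtain ⟨hb, hd⟩ := inBox_bFan3 n (by omega)
  have hN0 : (bFan3 n 0).toNat = n := by rw [bFan3_zero]; simp
  have hNq : (n : ℚ) ≠ 0 := by exact_mod_cast (show n ≠ 0 by omega)
  have hn' : (3 : ℚ) ≤ n := by exact_mod_cast hn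
  have h31 : (3 * (n : ℚ) - 1) ≠ 0 := by intro h; linarith
  have h32 : (3 * (n : ℚ) - 2) ≠ 0 := by intro h; linarith
  have hPi3 : PiPoly (bFan3 n) = X * (X + C ((n : ℚ) - 1)) * (X + C (2 * ((n : ℚ) - 2))) := PiPoly_bFan3 n
  have key := quadM3_eq_of_rank_two (bFan3 n) hb (by rw [hd]; omega) (by rw [hN0]; omega) (i := 0) (by simp)
    (by rw [bFan3_zero, bFan3_apply]; simp; omega)
    {0, 1, 2} (fun k => if k = 0 then PhiZero n else if k = 1 then PhiOne n else PhiTwo n)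
    (fun k => if k = 0 then 1 else if k = 1 then X * (X + C ((n : ℚ) - 1)) else (X * (X + C ((n : ℚ) - 1))) ^ 2)
    (fun k => if k = 0 then (4 * (n : ℚ) ^ 3 - 12 * (n : ℚ) ^ 2 + 18 * n - 5) / (3 * n * (3 * (n : ℚ) - 1))
      else if k = 1 then -1 / (3 * (n : ℚ) - 1) else 0)
    (fun k => if k = 0 then -(13 * (n : ℚ) ^ 6 - 101 * (n : ℚ) ^ 5 + 390 * (n : ℚ) ^ 4 - 810 * (n : ℚ) ^ 3 + 979 * (n : ℚ) ^ 2
        - 537 * n + 98) / (3 * n * (3 * (n : ℚ) - 2) * (3 * (n : ℚ) - 1))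
      else if k = 1 then 4 * ((n : ℚ) ^ 3 - 6 * (n : ℚ) ^ 2 + 14 * n - 7) / ((3 * (n : ℚ) - 2) * (3 * (n : ℚ) - 1))
      else -1 / (3 * (n : ℚ) - 2))
    ((n : ℚ) ^ 4 * (4 * (n : ℚ) ^ 3 - 12 * (n : ℚ) ^ 2 + 18 * n - 5) / (3 * (3 * (n : ℚ) - 1)))
    ((13 * (n : ℚ) ^ 5 - 45 * (n : ℚ) ^ 4 + 90 * (n : ℚ) ^ 3 - 80 * (n : ℚ) ^ 2 + 54 * n - 12) / (3 * (3 * (n : ℚ) - 1)))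
    (-(n : ℚ) ^ 4 * (13 * (n : ℚ) ^ 6 - 101 * (n : ℚ) ^ 5 + 390 * (n : ℚ) ^ 4 - 810 * (n : ℚ) ^ 3 + 979 * (n : ℚ) ^ 2
        - 537 * n + 98) / (3 * (3 * (n : ℚ) - 2) * (3 * (n : ℚ) - 1)))
    (-2 * (20 * (n : ℚ) ^ 8 - 160 * (n : ℚ) ^ 7 + 660 * (n : ℚ) ^ 6 - 1575 * (n : ℚ) ^ 5 + 2483 * (n : ℚ) ^ 4
        - 2469 * (n : ℚ) ^ 3 + 1681 * (n : ℚ) ^ 2 - 684 * n + 108) / (3 * (3 * (n : ℚ) - 2) * (3 * (n : ℚ) - 1)))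
    (fun k hk => by
      rw [hN0]
      simp only [mem_insert, mem_singleton] at hk
      rcases hk with rfl | rfl | rfl
      · simp only [if_true]; exact polyNum_PhiZero n
      · simp only [one_ne_zero, if_false, if_true]; exact polyNum_PhiOne n
      · simp only [show (2 : ℕ) ≠ 0 by norm_num, show (2 : ℕ) ≠ 1 by norm_num, if_false]; exact polyNum_PhiTwo n)
    (fun k hk => by
      rw [hN0]
      simp only [mem_insert, mem_singleton] at hk
      rcases hk with rfl | rfl | rfl
      · simp; omega
      · simp only [one_ne_zero, if_false, if_true]
        have : (X * (X + C ((n : ℚ) - 1))).natDegree ≤ 2 := by compute_degree!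
        omega
      · simp only [show (2 : ℕ) ≠ 0 by norm_num, show (2 : ℕ) ≠ 1 by norm_num, if_false]
        have : ((X * (X + C ((n : ℚ) - 1))) ^ 2).natDegree ≤ 4 := by compute_degree!
        omega)
    (by
      rw [hPi3, sum_insert (by simp), sum_pair (by norm_num)]
      simp only [if_true, one_ne_zero, if_false, show (2 : ℕ) ≠ 0 by norm_num, show (2 : ℕ) ≠ 1 by norm_num, PhiZero,
        PhiOne]
      apply Polynomial.funext; intro x
      simp only [eval_add, eval_mul, eval_C, eval_X, eval_pow, eval_neg, neg_mul, zero_mul, add_zero]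
      set k := 3 * (n : ℚ) - 1 with hk
      rw [show (1 - 3 * (n : ℚ)) = -k by rw [hk]; ring]
      field_simp
      rw [hk]
      ring)
    (by
      rw [PiPoly_bFan4, sum_insert (by simp), sum_pair (by norm_num)]
      simp only [if_true, one_ne_zero, if_false, show (2 : ℕ) ≠ 0 by norm_num, show (2 : ℕ) ≠ 1 by norm_num, PhiZero,
        PhiOne, PhiTwo]
      apply Polynomial.funext; intro x
      simp only [eval_add, eval_mul, eval_C, eval_X, eval_pow, eval_neg, neg_mul]
      set k := 3 * (n : ℚ) - 1 with hk
      set k' := 3 * (n : ℚ) - 2 with hk'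
      rw [show (1 - 3 * (n : ℚ)) = -k by rw [hk]; ring, show (2 - 3 * (n : ℚ)) = -k' by rw [hk']; ring]
      field_simp
      rw [hk, hk']
      ring)
  rw [key, hN0]
  congr 1
  set k := 3 * (n : ℚ) - 1 with hk
  set k' := 3 * (n : ℚ) - 2 with hk'
  field_simp
  ring

/-- **gen-1 g4's fan formula at `k = 3`**: `M₃(n;3,0⁶) = (−1)ⁿ·4·(3n−3)!·(n(n−1)(n−2))⁵/n!¹⁵` for `n ≥ 3`. -/
theorem quadM3_fan_three_closed (n : ℕ) (hn : 3 ≤ n) :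
    quadM3 (bFan3 n) =
      (-1) ^ n * 4 * ((3 * n - 3).factorial : ℚ) * ((n : ℚ) * ((n : ℚ) - 1) * ((n : ℚ) - 2)) ^ 5 / (n.factorial : ℚ) ^ 15 := by
  rw [quadM3_fan_three n hn, quadM3_bCorner]
  obtain ⟨m, rfl⟩ : ∃ m, n = m + 3 := ⟨n - 3, by omega⟩
  rw [show 3 * (m + 3) - 3 = 3 * m + 6 by omega]
  have hf : ((3 * (m + 3)).factorial : ℚ) = (3 * m + 9) * (3 * m + 8) * (3 * m + 7) * ((3 * m + 6).factorial : ℚ) := by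
    rw [show 3 * (m + 3) = (3 * m + 6) + 1 + 1 + 1 by omega, Nat.factorial_succ, Nat.factorial_succ, Nat.factorial_succ]
    push_cast
    ring
  rw [hf]
  push_cast
  rw [show (3 * ((m : ℚ) + 3) - 1) = 3 * m + 8 by ring, show (3 * ((m : ℚ) + 3) - 2) = 3 * m + 7 by ring]
  have h8 : (3 * (m : ℚ) + 8) ≠ 0 := by positivity
  have h7 : (3 * (m : ℚ) + 7) ≠ 0 := by positivity
  have hF : (((m + 3).factorial : ℕ) : ℚ) ≠ 0 := by positivity
  field_simp
  ring

end Summit.KontsevichZagierPeriods.Zeta5Search.WedgeDictionary
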